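import Mathlib
import Summits.MatrixMultiplication.MatrixMultiplication.Theorems.SnSubsetDichotomyPolynomialSlackBalancedThreeQuarters

/-!
# Polynomially balanced TPP triples in `S_n`: slack exponent `3/4 - a/2` (unconditional)

Crux `Summit.MatrixMultiplication.MatrixMultiplication.Theses.SnSubsetDichotomy.PolynomialSlack`
(item `stmt-MatrixMultiplication-8306`), level-one programme: the quantitative form of the balanced
milestone. `slack_of_ratio`: for reals `a ≥ 0` and `C` with `C + a/2 < 3/4` there is `n₀` such that every
TPP triple `S, T, U ⊆ S_n`, `n ≥ n₀`, whose three sizes are within a factor `n^a` of each other satisfies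
`|S||T||U|·n^C ≤ (n!)^{3/2}`. (`a = 0` is `balanced_slack_of_lt_threeQuarters` with equality of sizes
relaxed to mutual comparability; contrapositively, a violator of the crux inequality at exponent
`C ∈ [1/2, 3/4)` has two members whose sizes differ by a factor `> n^{3/2 - 2C - o(1)}`.)

Proof: `nearWall` with `ν = (|S||T||U|)^{1/3}`, `p = n^{C/3}`, `r = n^{a/3}`: each pair product `x` has
`x ≤ n!`, `x ≥ ν⁶/(n!)²` and `x ≤ r²ν²`; if `ν·p > √(n!)` then `(1 + log n)·log(4n·n!/x) ≤ 6 log² n`, so the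
pair terms contribute at most `60√6·n!·r·ν·log n/√n`, and the three terms of `nearWall` are each below
`ν³/12` once `n^{1-C} ≥ 64` and `720√6·log n·n^{2C/3 + a/3} ≤ √n` — eventually true since `2C + a < 3/2`.
-/

namespace Summit.MatrixMultiplication.MatrixMultiplication.Theorems.PolynomialSlack

open scoped BigOperators
open Literature.Combinatorics.Additive (TripleProductProperty)

-- `Summit.<Summit>.<Problem>` is the tree's mandated summit-side namespace (CONVENTIONS §2); for
-- this single-conjunct summit the two coincide, so each declaration silences `dupNamespace`.
set_option linter.dupNamespace false

/-- **Polynomially balanced TPP triples have polynomial slack up to exponent `3/4 - a/2`**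
(unconditional): for reals `0 ≤ a` and `C` with `C + a/2 < 3/4` there is `n₀` such that for all `n ≥ n₀`
and all `S, T, U ⊆ S_n` with the triple product property whose sizes are pairwise within a factor `n^a`,
`|S||T||U|·n^C ≤ (n!)^{3/2}`. -/
theorem slack_of_ratio (C a : ℝ) (ha : 0 ≤ a) (hC : C + a / 2 < 3 / 4) :
    ∃ n₀ : ℕ, ∀ n ≥ n₀, ∀ S T U : Finset (Equiv.Perm (Fin n)), TripleProductProperty S T U →
      (S.card : ℝ) ≤ (n : ℝ) ^ a * T.card → (S.card : ℝ) ≤ (n : ℝ) ^ a * U.card →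
      (T.card : ℝ) ≤ (n : ℝ) ^ a * S.card → (T.card : ℝ) ≤ (n : ℝ) ^ a * U.card →
      (U.card : ℝ) ≤ (n : ℝ) ^ a * S.card → (U.card : ℝ) ≤ (n : ℝ) ^ a * T.card →
      ((S.card * T.card * U.card : ℕ) : ℝ) * (n : ℝ) ^ C ≤ (n.factorial : ℝ) ^ ((3 : ℝ) / 2) := by
  by_cases hC2 : C < 1 / 2
  · obtain ⟨n₀, hn₀⟩ := polynomialSlack_of_lt_half C hC2
    exact ⟨n₀, fun n hn S T U hTPP _ _ _ _ _ _ => hn₀ n hn S T U hTPP⟩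
  rw [not_lt] at hC2
  have h1C : 0 < 1 - C := by linarith
  have h2e : 0 < 1 / 2 - 2 * C / 3 - a / 3 := by linarith
  -- the constant of the third term
  set c : ℝ := 1 / (720 * Real.sqrt 6) with hc
  have hc0 : 0 < c := by positivity
  -- eventual facts in a real variable
  have E1 : ∀ᶠ x : ℝ in Filter.atTop, 64 ≤ x ^ (1 - C) := (tendsto_rpow_atTop h1C).eventually_ge_atTop 64
  have E2 : ∀ᶠ x : ℝ in Filter.atTop, Real.log x ≤ c * x ^ (1 / 2 - 2 * C / 3 - a / 3) := by
    have := (isLittleO_log_rpow_atTop h2e).def (c := c) hc0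
    filter_upwards [this, Filter.eventually_ge_atTop 1] with x hx hx1
    rw [Real.norm_eq_abs, Real.norm_eq_abs, abs_of_nonneg (Real.log_nonneg hx1),
      abs_of_nonneg (Real.rpow_nonneg (by linarith) _)] at hx
    exact hx
  obtain ⟨x₀, hx₀⟩ := Filter.eventually_atTop.mp (E1.and (E2.and (Filter.eventually_ge_atTop 40)))
  refine ⟨⌈x₀⌉₊, fun n hn S T U hTPP hST hSU hTS hTU hUS hUT => ?_⟩
  have hnx : x₀ ≤ n := (Nat.le_ceil x₀).trans (by exact_mod_cast hn)
  obtain ⟨hE1, hE2, h40⟩ := hx₀ n hnx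
  have hn40 : 40 ≤ n := by exact_mod_cast h40
  have hn0 : (0 : ℝ) < n := by linarith only [h40]
  have hF0 : (0 : ℝ) < n.factorial := by exact_mod_cast n.factorial_pos
  -- the degenerate case
  by_cases hN0 : S.card * T.card * U.card = 0
  · rw [hN0, Nat.cast_zero, zero_mul]; positivity
  have hS0 : S.card ≠ 0 := fun h => hN0 (by simp [h])
  have hT0 : T.card ≠ 0 := fun h => hN0 (by simp [h])
  have hU0 : U.card ≠ 0 := fun h => hN0 (by simp [h])
  have hSne : S.Nonempty := Finset.card_pos.mp (Nat.pos_of_ne_zero hS0)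
  have hTne : T.Nonempty := Finset.card_pos.mp (Nat.pos_of_ne_zero hT0)
  have hUne : U.Nonempty := Finset.card_pos.mp (Nat.pos_of_ne_zero hU0)
  -- the near-wall inequality
  have hW := nearWall hn40 S T U hTPP
  -- the players: `ν = N^{1/3}`, `f = √(n!)`, `p = n^{C/3}`, `r = n^{a/3}`, `s = √n`, `ℓ² = log n`
  obtain ⟨ν, hν⟩ : ∃ ν : ℝ, ν = ((S.card * T.card * U.card : ℕ) : ℝ) ^ ((1 : ℝ) / 3) := ⟨_, rfl⟩
  obtain ⟨f, hf⟩ : ∃ f : ℝ, f = Real.sqrt (n.factorial : ℝ) := ⟨_, rfl⟩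
  obtain ⟨p, hp⟩ : ∃ p : ℝ, p = (n : ℝ) ^ (C / 3) := ⟨_, rfl⟩
  obtain ⟨r, hr⟩ : ∃ r : ℝ, r = (n : ℝ) ^ (a / 3) := ⟨_, rfl⟩
  obtain ⟨s, hs⟩ : ∃ s : ℝ, s = Real.sqrt (n : ℝ) := ⟨_, rfl⟩
  obtain ⟨ℓ, hℓ⟩ : ∃ ℓ : ℝ, ℓ = Real.sqrt (Real.log n) := ⟨_, rfl⟩
  have hNnn : (0 : ℝ) ≤ ((S.card * T.card * U.card : ℕ) : ℝ) := by positivity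
  have hν0 : 0 ≤ ν := by rw [hν]; exact Real.rpow_nonneg hNnn _
  have hf0 : 0 < f := by rw [hf]; exact Real.sqrt_pos.mpr hF0
  have hp1 : 1 ≤ p := by rw [hp]; exact Real.one_le_rpow (by linarith only [h40]) (by linarith only [hC2])
  have hp0 : 0 < p := by linarith only [hp1]
  have hr1 : 1 ≤ r := by rw [hr]; exact Real.one_le_rpow (by linarith only [h40]) (by linarith only [ha])
  have hr0 : 0 < r := by linarith only [hr1]
  have hs0 : 0 < s := by rw [hs]; exact Real.sqrt_pos.mpr hn0
  have hℓ0 : 0 ≤ ℓ := by rw [hℓ]; exact Real.sqrt_nonneg _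
  have hlog1 : 1 ≤ Real.log n := by
    rw [← Real.log_exp 1]
    exact Real.log_le_log (Real.exp_pos 1) (le_trans (le_of_lt (lt_trans Real.exp_one_lt_d9 (by norm_num))) h40)
  have hlogℓ : Real.log n = ℓ ^ 2 := by rw [hℓ, Real.sq_sqrt (by linarith)]
  have hFf : (n.factorial : ℝ) = f ^ 2 := by rw [hf, Real.sq_sqrt hF0.le]
  -- `N = ν³`, `n^C = p³`, `n^a = r³`, `(n!)^{3/2} = f³`
  have hNν : ((S.card * T.card * U.card : ℕ) : ℝ) = ν ^ 3 := by
    rw [hν, ← Real.rpow_natCast, ← Real.rpow_mul hNnn]; norm_num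
  have hnC : (n : ℝ) ^ C = p ^ 3 := by
    rw [hp, ← Real.rpow_natCast, ← Real.rpow_mul hn0.le]; congr 1; push_cast; ring
  have hna : (n : ℝ) ^ a = r ^ 3 := by
    rw [hr, ← Real.rpow_natCast, ← Real.rpow_mul hn0.le]; congr 1; push_cast; ring
  have hF32 : (n.factorial : ℝ) ^ ((3 : ℝ) / 2) = f ^ 3 := by
    rw [hf, Real.sqrt_eq_rpow, ← Real.rpow_natCast, ← Real.rpow_mul hF0.le]; congr 1; norm_num
  rw [hna] at hST hSU hTS hTU hUS hUT
  -- the three sizes and pair products as reals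
  obtain ⟨u₁, hu₁⟩ : ∃ u : ℝ, u = (S.card : ℝ) := ⟨_, rfl⟩
  obtain ⟨u₂, hu₂⟩ : ∃ u : ℝ, u = (T.card : ℝ) := ⟨_, rfl⟩
  obtain ⟨u₃, hu₃⟩ : ∃ u : ℝ, u = (U.card : ℝ) := ⟨_, rfl⟩
  rw [← hu₁, ← hu₂] at hST
  rw [← hu₁, ← hu₃] at hSU
  rw [← hu₂, ← hu₁] at hTS
  rw [← hu₂, ← hu₃] at hTU
  rw [← hu₃, ← hu₁] at hUS
  rw [← hu₃, ← hu₂] at hUT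
  have hu₁0 : 0 < u₁ := by rw [hu₁]; exact_mod_cast Nat.pos_of_ne_zero hS0
  have hu₂0 : 0 < u₂ := by rw [hu₂]; exact_mod_cast Nat.pos_of_ne_zero hT0
  have hu₃0 : 0 < u₃ := by rw [hu₃]; exact_mod_cast Nat.pos_of_ne_zero hU0
  have hνu : ν ^ 3 = u₁ * u₂ * u₃ := by rw [← hNν, hu₁, hu₂, hu₃]; push_cast; ring
  have hAc : ((S.card * T.card : ℕ) : ℝ) = u₁ * u₂ := by rw [hu₁, hu₂]; push_cast; ring
  have hBc : ((T.card * U.card : ℕ) : ℝ) = u₂ * u₃ := by rw [hu₂, hu₃]; push_cast; ring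
  have hCc : ((U.card * S.card : ℕ) : ℝ) = u₃ * u₁ := by rw [hu₃, hu₁]; push_cast; ring
  -- packing: each pair product is at most `n! = f²`
  have hAF : u₁ * u₂ ≤ f ^ 2 := by
    rw [← hAc, ← hFf]; exact_mod_cast card_mul_card_le_factorial_of_injOn (injOn_quot_first hTPP hUne)
  have hBF : u₂ * u₃ ≤ f ^ 2 := by
    rw [← hBc, ← hFf]; exact_mod_cast card_mul_card_le_factorial_of_injOn (injOn_quot_second hTPP hSne)
  have hCF : u₃ * u₁ ≤ f ^ 2 := by
    rw [← hCc, ← hFf]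
    exact_mod_cast card_mul_card_le_factorial_of_injOn (injOn_quot_first hTPP.rotate.rotate hTne)
  rw [hNν, hAc, hBc, hCc] at hW
  rw [hNν, hnC, hF32]
  -- (E1'): `64 p^3 ≤ n`
  have hE1' : 64 * p ^ 3 ≤ n := by
    have e : (n : ℝ) = (n : ℝ) ^ (1 - C) * p ^ 3 := by
      rw [← hnC, ← Real.rpow_add hn0, sub_add_cancel, Real.rpow_one]
    rw [e]; exact mul_le_mul_of_nonneg_right hE1 (by positivity)
  -- (E2'): `720 √6 ℓ² p² r ≤ s`
  have hE2' : 720 * Real.sqrt 6 * ℓ ^ 2 * p ^ 2 * r ≤ s := by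
    have h1 : ℓ ^ 2 ≤ c * (n : ℝ) ^ (1 / 2 - 2 * C / 3 - a / 3) := by rw [← hlogℓ]; exact hE2
    have h2 : p ^ 2 = (n : ℝ) ^ (2 * C / 3) := by
      rw [hp, ← Real.rpow_natCast, ← Real.rpow_mul hn0.le]; congr 1; push_cast; ring
    have h3 : (n : ℝ) ^ (1 / 2 - 2 * C / 3 - a / 3) * (n : ℝ) ^ (2 * C / 3) * (n : ℝ) ^ (a / 3) = s := by
      rw [← Real.rpow_add hn0, ← Real.rpow_add hn0, hs, Real.sqrt_eq_rpow]; congr 1; ring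
    have h4 : ℓ ^ 2 * p ^ 2 * r ≤ c * s := by
      rw [← h3, h2, hr, ← mul_assoc, ← mul_assoc]
      exact mul_le_mul_of_nonneg_right
        (mul_le_mul_of_nonneg_right h1 (Real.rpow_nonneg hn0.le _)) (Real.rpow_nonneg hn0.le _)
    have h5 : 720 * Real.sqrt 6 * c = 1 := by rw [hc]; field_simp
    calc 720 * Real.sqrt 6 * ℓ ^ 2 * p ^ 2 * r = 720 * Real.sqrt 6 * (ℓ ^ 2 * p ^ 2 * r) := by ring
      _ ≤ 720 * Real.sqrt 6 * (c * s) := mul_le_mul_of_nonneg_left h4 (by positivity)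
      _ = s := by rw [← mul_assoc, h5, one_mul]
  -- `f ≥ n/2` and hence `f ≥ 32 p^3`
  have hfn : (n : ℝ) / 2 ≤ f := by
    have h1 : ((n * (n - 1) : ℕ) : ℝ) ≤ n.factorial := by
      have : n * (n - 1) ≤ n.factorial := by
        rw [← Nat.mul_factorial_pred (show n ≠ 0 by omega)]
        exact Nat.mul_le_mul_left n (Nat.self_le_factorial _)
      exact_mod_cast this
    have h2 : ((n * (n - 1) : ℕ) : ℝ) = (n : ℝ) * ((n : ℝ) - 1) := by
      push_cast [Nat.cast_sub (show 1 ≤ n by omega)]; ring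
    have h3 : ((n : ℝ) / 2) ^ 2 ≤ n.factorial := by nlinarith only [h1, h2, h40]
    have := Real.abs_le_sqrt h3
    rwa [abs_of_nonneg (by positivity), ← hf] at this
  -- proof by contradiction: suppose `f < ν p`
  by_contra hcon
  have hlt : f < ν * p := by
    refine not_le.mp fun h => hcon ?_
    calc ν ^ 3 * p ^ 3 = (ν * p) ^ 3 := by ring
      _ ≤ f ^ 3 := pow_le_pow_left₀ (by positivity) h 3
  have hf2 : f ^ 2 < ν ^ 2 * p ^ 2 := by
    have := mul_self_lt_mul_self hf0.le hlt
    nlinarith only [this]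
  have hf3 : f ^ 3 < ν ^ 3 * p ^ 3 := by
    have h1 : f ^ 2 * f < f ^ 2 * (ν * p) := mul_lt_mul_of_pos_left hlt (by positivity)
    have h2 : f ^ 2 * (ν * p) ≤ ν ^ 2 * p ^ 2 * (ν * p) := mul_le_mul_of_nonneg_right hf2.le (by positivity)
    nlinarith only [h1, h2]
  have hf6 : f ^ 6 < ν ^ 6 * p ^ 6 := by
    have := mul_self_lt_mul_self (by positivity) hf3
    nlinarith only [this]
  have hν32 : 32 * p ^ 2 < ν := by
    have h1 : 32 * p ^ 3 ≤ f := by linarith only [hE1', hfn]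
    have h2 : 32 * p ^ 2 * p < ν * p := by
      calc 32 * p ^ 2 * p = 32 * p ^ 3 := by ring
        _ ≤ f := h1
        _ < ν * p := hlt
    exact lt_of_mul_lt_mul_right h2 hp0.le
  have hνpos : 0 < ν := lt_of_le_of_lt (by positivity) hν32
  have h2p : 4 * p ^ 6 ≤ (n : ℝ) ^ 2 := by
    have h : 2 * p ^ 3 ≤ n := by linarith only [hE1', hp0]
    have := pow_le_pow_left₀ (by positivity) h 2
    nlinarith only [this]
  -- per pair product `x`: the logarithm and the pair term
  have key : ∀ x : ℝ, 0 < x → x ≤ f ^ 2 → ν ^ 6 ≤ x * f ^ 2 * f ^ 2 → x ^ 3 ≤ r ^ 6 * ν ^ 6 →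
      Real.sqrt (x * ((1 + Real.log n) * Real.log (4 * n * n.factorial / x))) ≤ r * ν * (Real.sqrt 6 * ℓ ^ 2) := by
    intro x hx hxF hνx hxr
    -- `log(4 n n!/x) ≤ 3 log n`
    have hq : 4 * n * n.factorial / x ≤ (n : ℝ) ^ 3 := by
      rw [div_le_iff₀ hx, hFf]
      have h1 : f ^ 2 * f ^ 4 < p ^ 6 * x * f ^ 4 := by
        have h := mul_le_mul_of_nonneg_right hνx (by positivity : (0 : ℝ) ≤ p ^ 6)
        nlinarith only [hf6, h]
      have h2 : f ^ 2 < p ^ 6 * x := lt_of_mul_lt_mul_right h1 (by positivity)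
      calc 4 * (n : ℝ) * f ^ 2 ≤ 4 * n * (p ^ 6 * x) := mul_le_mul_of_nonneg_left h2.le (by positivity)
        _ = (4 * p ^ 6) * (n * x) := by ring
        _ ≤ (n : ℝ) ^ 2 * (n * x) := mul_le_mul_of_nonneg_right h2p (by positivity)
        _ = (n : ℝ) ^ 3 * x := by ring
    have hL : Real.log (4 * n * n.factorial / x) ≤ 3 * ℓ ^ 2 := by
      calc Real.log (4 * n * n.factorial / x) ≤ Real.log ((n : ℝ) ^ 3) :=
            Real.log_le_log (by positivity) hq
        _ = 3 * ℓ ^ 2 := by rw [Real.log_pow, hlogℓ]; push_cast; ring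
    have hL0 : 0 ≤ Real.log (4 * n * n.factorial / x) := by
      apply Real.log_nonneg
      rw [le_div_iff₀ hx, hFf]
      nlinarith only [hxF, h40, hf0]
    have hGL : (1 + Real.log n) * Real.log (4 * n * n.factorial / x) ≤ (Real.sqrt 6 * ℓ ^ 2) ^ 2 := by
      have hG : 1 + Real.log n ≤ 2 * ℓ ^ 2 := by rw [← hlogℓ]; linarith only [hlog1]
      have h6 : Real.sqrt 6 ^ 2 = 6 := Real.sq_sqrt (by norm_num)
      calc (1 + Real.log n) * Real.log (4 * n * n.factorial / x) ≤ (2 * ℓ ^ 2) * (3 * ℓ ^ 2) :=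
            mul_le_mul hG hL hL0 (by positivity)
        _ = (Real.sqrt 6 * ℓ ^ 2) ^ 2 := by rw [mul_pow, h6]; ring
    -- `√x ≤ r ν`
    have hxr' : x ≤ (r * ν) ^ 2 := by
      have : x ^ 3 ≤ ((r * ν) ^ 2) ^ 3 := by
        calc x ^ 3 ≤ r ^ 6 * ν ^ 6 := hxr
          _ = ((r * ν) ^ 2) ^ 3 := by ring
      exact le_of_pow_le_pow_left₀ three_ne_zero (by positivity) this
    calc Real.sqrt (x * ((1 + Real.log n) * Real.log (4 * n * n.factorial / x)))
        ≤ Real.sqrt ((r * ν) ^ 2 * (Real.sqrt 6 * ℓ ^ 2) ^ 2) :=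
          Real.sqrt_le_sqrt (mul_le_mul hxr' hGL (mul_nonneg (by linarith only [hlog1]) hL0) (by positivity))
      _ = r * ν * (Real.sqrt 6 * ℓ ^ 2) := by
          rw [Real.sqrt_mul (sq_nonneg _), Real.sqrt_sq (by positivity), Real.sqrt_sq (by positivity)]
  -- the three instances
  have hXA : Real.sqrt (u₁ * u₂ * ((1 + Real.log n) * Real.log (4 * n * n.factorial / (u₁ * u₂)))) ≤
      r * ν * (Real.sqrt 6 * ℓ ^ 2) := by
    refine key (u₁ * u₂) (by positivity) hAF ?_ ?_
    · calc ν ^ 6 = (u₁ * u₂) * (u₂ * u₃) * (u₃ * u₁) := by rw [show ν ^ 6 = (ν ^ 3) ^ 2 by ring, hνu]; ring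
        _ ≤ (u₁ * u₂) * f ^ 2 * f ^ 2 := by
            have := mul_le_mul hBF hCF (by positivity) (by positivity)
            have h := mul_le_mul_of_nonneg_left this (by positivity : (0 : ℝ) ≤ u₁ * u₂)
            nlinarith only [h]
    · have h12 : u₁ * u₂ ≤ (r ^ 3 * u₃) * (r ^ 3 * u₃) := mul_le_mul hSU hTU hu₂0.le (by positivity)
      have := mul_le_mul_of_nonneg_left h12 (by positivity : (0 : ℝ) ≤ (u₁ * u₂) ^ 2)
      calc (u₁ * u₂) ^ 3 = (u₁ * u₂) ^ 2 * (u₁ * u₂) := by ring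
        _ ≤ (u₁ * u₂) ^ 2 * ((r ^ 3 * u₃) * (r ^ 3 * u₃)) := this
        _ = r ^ 6 * (u₁ * u₂ * u₃) ^ 2 := by ring
        _ = r ^ 6 * ν ^ 6 := by rw [← hνu]; ring
  have hXB : Real.sqrt (u₂ * u₃ * ((1 + Real.log n) * Real.log (4 * n * n.factorial / (u₂ * u₃)))) ≤
      r * ν * (Real.sqrt 6 * ℓ ^ 2) := by
    refine key (u₂ * u₃) (by positivity) hBF ?_ ?_
    · calc ν ^ 6 = (u₂ * u₃) * (u₃ * u₁) * (u₁ * u₂) := by rw [show ν ^ 6 = (ν ^ 3) ^ 2 by ring, hνu]; ring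
        _ ≤ (u₂ * u₃) * f ^ 2 * f ^ 2 := by
            have := mul_le_mul hCF hAF (by positivity) (by positivity)
            have h := mul_le_mul_of_nonneg_left this (by positivity : (0 : ℝ) ≤ u₂ * u₃)
            nlinarith only [h]
    · have h23 : u₂ * u₃ ≤ (r ^ 3 * u₁) * (r ^ 3 * u₁) := mul_le_mul hTS hUS hu₃0.le (by positivity)
      have := mul_le_mul_of_nonneg_left h23 (by positivity : (0 : ℝ) ≤ (u₂ * u₃) ^ 2)
      calc (u₂ * u₃) ^ 3 = (u₂ * u₃) ^ 2 * (u₂ * u₃) := by ring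
        _ ≤ (u₂ * u₃) ^ 2 * ((r ^ 3 * u₁) * (r ^ 3 * u₁)) := this
        _ = r ^ 6 * (u₁ * u₂ * u₃) ^ 2 := by ring
        _ = r ^ 6 * ν ^ 6 := by rw [← hνu]; ring
  have hXC : Real.sqrt (u₃ * u₁ * ((1 + Real.log n) * Real.log (4 * n * n.factorial / (u₃ * u₁)))) ≤
      r * ν * (Real.sqrt 6 * ℓ ^ 2) := by
    refine key (u₃ * u₁) (by positivity) hCF ?_ ?_
    · calc ν ^ 6 = (u₃ * u₁) * (u₁ * u₂) * (u₂ * u₃) := by rw [show ν ^ 6 = (ν ^ 3) ^ 2 by ring, hνu]; ring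
        _ ≤ (u₃ * u₁) * f ^ 2 * f ^ 2 := by
            have := mul_le_mul hAF hBF (by positivity) (by positivity)
            have h := mul_le_mul_of_nonneg_left this (by positivity : (0 : ℝ) ≤ u₃ * u₁)
            nlinarith only [h]
    · have h31 : u₃ * u₁ ≤ (r ^ 3 * u₂) * (r ^ 3 * u₂) := mul_le_mul hUT hST hu₁0.le (by positivity)
      have := mul_le_mul_of_nonneg_left h31 (by positivity : (0 : ℝ) ≤ (u₃ * u₁) ^ 2)
      calc (u₃ * u₁) ^ 3 = (u₃ * u₁) ^ 2 * (u₃ * u₁) := by ring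
        _ ≤ (u₃ * u₁) ^ 2 * ((r ^ 3 * u₂) * (r ^ 3 * u₂)) := this
        _ = r ^ 6 * (u₁ * u₂ * u₃) ^ 2 := by ring
        _ = r ^ 6 * ν ^ 6 := by rw [← hνu]; ring
  -- the middle term: `n! √(n!)/√(n(n-1)/6) ≤ √12 f^3/n`
  have hG : (n.factorial : ℝ) * Real.sqrt (n.factorial : ℝ) / Real.sqrt (((n * (n - 1) : ℕ) : ℝ) / 6) ≤
      Real.sqrt 12 * f ^ 3 / n := by
    have h2 : ((n * (n - 1) : ℕ) : ℝ) = (n : ℝ) * ((n : ℝ) - 1) := by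
      push_cast [Nat.cast_sub (show 1 ≤ n by omega)]; ring
    have hd : (n : ℝ) / Real.sqrt 12 ≤ Real.sqrt (((n * (n - 1) : ℕ) : ℝ) / 6) := by
      rw [h2]
      have h12 : (0 : ℝ) < Real.sqrt 12 := by positivity
      rw [div_le_iff₀ h12]
      have h6 : (0 : ℝ) ≤ (n : ℝ) * ((n : ℝ) - 1) / 6 :=
        div_nonneg (mul_nonneg hn0.le (by linarith only [h40])) (by norm_num)
      rw [← Real.sqrt_mul h6 12]
      refine (le_of_eq (Real.sqrt_sq hn0.le).symm).trans (Real.sqrt_le_sqrt ?_)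
      nlinarith only [h40]
    have hnum : 0 ≤ (n.factorial : ℝ) * Real.sqrt (n.factorial : ℝ) := by positivity
    calc (n.factorial : ℝ) * Real.sqrt (n.factorial : ℝ) / Real.sqrt (((n * (n - 1) : ℕ) : ℝ) / 6)
        ≤ (n.factorial : ℝ) * Real.sqrt (n.factorial : ℝ) / ((n : ℝ) / Real.sqrt 12) :=
          div_le_div_of_nonneg_left hnum (by positivity) hd
      _ = Real.sqrt 12 * f ^ 3 / n := by rw [← hf, hFf]; field_simp
  -- assemble: `ν³/4 ≤ f² + √12 f³/n + 60 √6 f² r ν ℓ²/s`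
  rw [← hs] at hW
  have h20 : (0 : ℝ) ≤ 20 * (n.factorial : ℝ) / s := by positivity
  have hsumX := mul_le_mul_of_nonneg_left (add_le_add (add_le_add hXA hXB) hXC) h20
  have hmain : ν ^ 3 / 4 ≤ f ^ 2 + Real.sqrt 12 * f ^ 3 / n + 60 * Real.sqrt 6 * f ^ 2 * r * ν * ℓ ^ 2 / s := by
    have e : 20 * (n.factorial : ℝ) / s *
        (r * ν * (Real.sqrt 6 * ℓ ^ 2) + r * ν * (Real.sqrt 6 * ℓ ^ 2) + r * ν * (Real.sqrt 6 * ℓ ^ 2)) =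
        60 * Real.sqrt 6 * f ^ 2 * r * ν * ℓ ^ 2 / s := by rw [hFf]; ring
    rw [e] at hsumX
    linarith only [hW, hG, hsumX, hFf]
  -- the three terms are each at most `ν³/12`, the first strictly
  have hs12 : Real.sqrt 12 < 4 := by
    rw [show (4 : ℝ) = Real.sqrt 16 by rw [show (16 : ℝ) = 4 ^ 2 by norm_num, Real.sqrt_sq (by norm_num)]]
    exact Real.sqrt_lt_sqrt (by norm_num) (by norm_num)
  have hT1 : f ^ 2 < ν ^ 3 / 12 := by
    have : ν ^ 2 * p ^ 2 ≤ ν ^ 2 * (ν / 12) :=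
      mul_le_mul_of_nonneg_left (by linarith only [hν32, hνpos]) (sq_nonneg ν)
    nlinarith only [this, hf2]
  have hT2 : Real.sqrt 12 * f ^ 3 / n ≤ ν ^ 3 / 12 := by
    rw [div_le_iff₀ hn0]
    have h1 : Real.sqrt 12 * f ^ 3 ≤ Real.sqrt 12 * (ν ^ 3 * p ^ 3) :=
      mul_le_mul_of_nonneg_left hf3.le (Real.sqrt_nonneg _)
    have h2 : Real.sqrt 12 * p ^ 3 ≤ n / 12 := by
      have := mul_le_mul_of_nonneg_right hs12.le (by positivity : (0 : ℝ) ≤ p ^ 3)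
      linarith only [this, hE1']
    have h3 : Real.sqrt 12 * (ν ^ 3 * p ^ 3) = ν ^ 3 * (Real.sqrt 12 * p ^ 3) := by ring
    have h4 : ν ^ 3 * (Real.sqrt 12 * p ^ 3) ≤ ν ^ 3 * (n / 12) := mul_le_mul_of_nonneg_left h2 (by positivity)
    nlinarith only [h1, h3, h4]
  have hT3 : 60 * Real.sqrt 6 * f ^ 2 * r * ν * ℓ ^ 2 / s ≤ ν ^ 3 / 12 := by
    rw [div_le_iff₀ hs0]
    have h0 : 0 ≤ 60 * Real.sqrt 6 * r * ν * ℓ ^ 2 := by positivity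
    have h1 : 60 * Real.sqrt 6 * f ^ 2 * r * ν * ℓ ^ 2 ≤ 60 * Real.sqrt 6 * (ν ^ 2 * p ^ 2) * r * ν * ℓ ^ 2 := by
      calc 60 * Real.sqrt 6 * f ^ 2 * r * ν * ℓ ^ 2 = 60 * Real.sqrt 6 * r * ν * ℓ ^ 2 * f ^ 2 := by ring
        _ ≤ 60 * Real.sqrt 6 * r * ν * ℓ ^ 2 * (ν ^ 2 * p ^ 2) := mul_le_mul_of_nonneg_left hf2.le h0
        _ = 60 * Real.sqrt 6 * (ν ^ 2 * p ^ 2) * r * ν * ℓ ^ 2 := by ring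
    have h2 : 60 * Real.sqrt 6 * (ν ^ 2 * p ^ 2) * r * ν * ℓ ^ 2 =
        ν ^ 3 * (60 * Real.sqrt 6 * ℓ ^ 2 * p ^ 2 * r) := by ring
    have h3 : ν ^ 3 * (60 * Real.sqrt 6 * ℓ ^ 2 * p ^ 2 * r) ≤ ν ^ 3 * (s / 12) :=
      mul_le_mul_of_nonneg_left (by linarith only [hE2']) (by positivity)
    nlinarith only [h1, h2, h3]
  linarith only [hmain, hT1, hT2, hT3]

end Summit.MatrixMultiplication.MatrixMultiplication.Theorems.PolynomialSlack
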